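import Mathlib.Geometry.Manifold.WhitneyEmbedding

/-!
# A Whitney embedding of a compact neighbourhood, proper near the compact set
(registered helper `helper_localWhitney` of the stub `stub_normalWitnessTransfer`, line
`cross-cap-laurent`, crux `GromovRecognitionRelEnd`, item stmt-SmoothPoincare4-11009)

Setting: a (not necessarily compact) Hausdorff second-countable smooth `4`-manifold `X` and a
compact set `K ⊆ X`.  Claim: there are an open `U ⊇ K`, a compact `K₁ ⊆ U`, a smooth map
`e : X → ℝᵐ` which is injective with injective differential on `U`, and an `η > 0` such that every
`q ∈ U` whose image is `η`-close to `e (K)` lies in `K₁` ("properness near `K`").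

Proof (the Whitney embedding theorem for a compact neighbourhood, M. W. Hirsch, *Differential
Topology* (1976), Ch. 1 §3, Thm. 3.4, via the bump-covering map
`x ↦ (fᵢ x • chartᵢ x, fᵢ x)ᵢ` of Mathlib's `Mathlib.Geometry.Manifold.WhitneyEmbedding`, whose
three lemmas `embeddingPiTangent` (smoothness), `embeddingPiTangent_injOn` and
`embeddingPiTangent_injective_mfderiv` are re-proved here for a bump covering of a subset, plus
one extra bump coordinate).  `X` is locally compact (charted on `ℝ⁴`) and `σ`-compact.  Choose
nested opens `K ⊆ V₁`, `closure V₁ ⊆ V₂`, `closure V₂ ⊆ V₃ =: U` with compact closures and put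
`K₁ := closure V₂`.  A smooth bump covering `f` of the compact closed set `s := closure V₃`
(`SmoothBumpCovering.exists_isSubordinate`) has a finite index type (local finiteness of the
supports against the compact `s`, every bump being centred in `s`), so
`Φ := (x ↦ (fᵢ x • chartᵢ x, fᵢ x)ᵢ) : X → (ι → ℝ⁴ × ℝ)` is smooth, injective on `s` with
injective differential on `s`.  A smooth `λ : X → ℝ` with `λ = 1` on `closure V₁ ⊇ K` and `λ = 0`
off `V₂` (`exists_contMDiffMap_zero_one_of_isClosed`) is appended as a last coordinate and the
finite-dimensional target `(ι → ℝ⁴ × ℝ) × ℝ` is identified with `ℝᵐ` by a continuous linear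
isomorphism `T`; `e := T ∘ (Φ, λ)`.  Injectivity of `e` and of its differential on `U ⊆ s` follow
from those of the first component `Φ = (pr₁ ∘ T⁻¹) ∘ e`.  Properness: for `q ∈ U ∖ K₁` and
`p ∈ K` one has `λ q = 0`, `λ p = 1`, so `1 ≤ ‖(Φ q, λ q) - (Φ p, λ p)‖ ≤ ‖T⁻¹‖ · ‖e q - e p‖`,
which is impossible once `‖e q - e p‖ < η := 1 / (‖T⁻¹‖ + 1)`.
No new definitions.
-/

noncomputable section

open scoped Manifold ContDiff Topology
open Set Function Metric

-- the prescribed namespace `Summit.<P>.<Sub>.…` duplicates `SmoothPoincare4` (P = Sub)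
set_option linter.dupNamespace false

namespace Summit.SmoothPoincare4.SmoothPoincare4.Theorems.GromovRecognitionRelEnd.CrossCapLaurent

namespace HelperLocalWhitney

/-- **Finiteness of a bump covering of a compact set**: a smooth bump covering of a compact set
`s` has a finite index type (the supports form a locally finite family all of whose members meet
`s`, each bump being centred at a point of `s`). [folklore] -/
theorem finite_index {ι : Type*} {E : Type*} [NormedAddCommGroup E] [NormedSpace ℝ E]
    [FiniteDimensional ℝ E] {H : Type*} [TopologicalSpace H] {I : ModelWithCorners ℝ E H}
    {M : Type*} [TopologicalSpace M] [ChartedSpace H M] {s : Set M}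
    (f : SmoothBumpCovering ι I M s) (hs : IsCompact s) : Finite ι := by
  have hfin := f.locallyFinite.finite_nonempty_inter_compact hs
  refine Set.finite_univ_iff.mp (hfin.subset fun i _ => ?_)
  exact ⟨f.c i, (f i).c_mem_support, f.c_mem' i⟩

-- The next three lemmas are adapted from `Mathlib.Geometry.Manifold.WhitneyEmbedding`
-- (`embeddingPiTangent`, `embeddingPiTangent_injOn`, `comp_embeddingPiTangent_mfderiv`,
-- `embeddingPiTangent_injective_mfderiv`), stated for an abstract function `Φ` equal to the
-- bump-covering map, so that no definition is introduced.

/-- **Smoothness of the bump-covering map** `Φ x = (fᵢ x • chartᵢ x, fᵢ x)ᵢ` of a finite smooth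
bump covering (Whitney; Hirsch, *Differential Topology*, Ch. 1 §3). [folklore] -/
theorem contMDiff_piTangent {ι : Type*} [Fintype ι] {E : Type*} [NormedAddCommGroup E]
    [NormedSpace ℝ E] [FiniteDimensional ℝ E] {H : Type*} [TopologicalSpace H]
    {I : ModelWithCorners ℝ E H} {M : Type*} [TopologicalSpace M] [ChartedSpace H M]
    [T2Space M] [IsManifold I ∞ M] {s : Set M} (f : SmoothBumpCovering ι I M s)
    {Φ : M → ι → E × ℝ} (hΦ : Φ = fun x i => ((f i) x • extChartAt I (f.c i) x, (f i) x)) :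
    ContMDiff I 𝓘(ℝ, ι → E × ℝ) ∞ Φ := by
  subst hΦ
  exact contMDiff_pi_space.2 fun i =>
    ((f i).contMDiff_smul contMDiffOn_extChartAt).prodMk_space (f i).contMDiff

/-- **Injectivity of the bump-covering map on the covered set**: two points of `s` with the same
image under `Φ x = (fᵢ x • chartᵢ x, fᵢ x)ᵢ` lie in one chart, where the chart separates them
(Whitney; Hirsch, *Differential Topology*, Ch. 1 §3). [folklore] -/
theorem injOn_piTangent {ι : Type*} {E : Type*} [NormedAddCommGroup E]
    [NormedSpace ℝ E] [FiniteDimensional ℝ E] {H : Type*} [TopologicalSpace H]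
    {I : ModelWithCorners ℝ E H} {M : Type*} [TopologicalSpace M] [ChartedSpace H M]
    {s : Set M} (f : SmoothBumpCovering ι I M s)
    {Φ : M → ι → E × ℝ} (hΦ : Φ = fun x i => ((f i) x • extChartAt I (f.c i) x, (f i) x)) :
    InjOn Φ s := by
  subst hΦ
  intro x hx y _ h
  simp only [funext_iff] at h
  obtain ⟨h₁, h₂⟩ := Prod.mk_inj.1 (h (f.ind x hx))
  rw [f.apply_ind x hx] at h₂
  rw [← h₂, f.apply_ind x hx, one_smul, one_smul] at h₁
  have := f.mem_extChartAt_source_of_eq_one h₂.symm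
  exact (extChartAt I (f.c _)).injOn (f.mem_extChartAt_ind_source x hx) this h₁

/-- **The chart is a linear image of the differential of the bump-covering map**: near `x ∈ s`
the `ind x`-th `E`-component of `Φ` is the extended chart at `c (ind x)`, so composing `dΦ (x)`
with that coordinate projection gives the (invertible) differential of the chart
(Whitney; Hirsch, *Differential Topology*, Ch. 1 §3). [folklore] -/
theorem comp_mfderiv_piTangent {ι : Type*} [Fintype ι] {E : Type*} [NormedAddCommGroup E]
    [NormedSpace ℝ E] [FiniteDimensional ℝ E] {H : Type*} [TopologicalSpace H]
    {I : ModelWithCorners ℝ E H} {M : Type*} [TopologicalSpace M] [ChartedSpace H M]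
    [T2Space M] [IsManifold I ∞ M] {s : Set M} (f : SmoothBumpCovering ι I M s)
    {Φ : M → ι → E × ℝ} (hΦ : Φ = fun x i => ((f i) x • extChartAt I (f.c i) x, (f i) x))
    (x : M) (hx : x ∈ s) :
    ((ContinuousLinearMap.fst ℝ E ℝ).comp
      (@ContinuousLinearMap.proj ℝ _ ι (fun _ => E × ℝ) _ _ (fun _ => inferInstance)
        (f.ind x hx))).comp (mfderiv I 𝓘(ℝ, ι → E × ℝ) Φ x) =
      mfderiv I I (chartAt H (f.c (f.ind x hx))) x := by
  set L := (ContinuousLinearMap.fst ℝ E ℝ).comp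
    (@ContinuousLinearMap.proj ℝ _ ι (fun _ => E × ℝ) _ _ (fun _ => inferInstance) (f.ind x hx))
  have h₁ := L.hasMFDerivAt.comp x
    ((contMDiff_piTangent f hΦ).mdifferentiableAt (by simp)).hasMFDerivAt
  have hev : ⇑L ∘ Φ =ᶠ[𝓝 x] extChartAt I (f.c (f.ind x hx)) := by
    refine (f.eventuallyEq_one x hx).mono fun y hy => ?_
    simp only [L, hΦ, ContinuousLinearMap.coe_comp, Function.comp_apply,
      ContinuousLinearMap.coe_fst', ContinuousLinearMap.proj_apply]
    rw [hy, Pi.one_apply, one_smul]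
  have h₂ : HasMFDerivAt I 𝓘(ℝ, E) (⇑L ∘ Φ) x (mfderiv I I (chartAt H (f.c (f.ind x hx))) x) :=
    (hasMFDerivAt_extChartAt (f.mem_chartAt_ind_source x hx)).congr_of_eventuallyEq hev
  have h₃ := hasMFDerivAt_unique h₁ h₂
  exact h₃

/-- **The bump-covering map is an immersion on the covered set**
(Whitney; Hirsch, *Differential Topology*, Ch. 1 §3). [folklore] -/
theorem injective_mfderiv_piTangent {ι : Type*} [Fintype ι] {E : Type*} [NormedAddCommGroup E]
    [NormedSpace ℝ E] [FiniteDimensional ℝ E] {H : Type*} [TopologicalSpace H]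
    {I : ModelWithCorners ℝ E H} {M : Type*} [TopologicalSpace M] [ChartedSpace H M]
    [T2Space M] [IsManifold I ∞ M] {s : Set M} (f : SmoothBumpCovering ι I M s)
    {Φ : M → ι → E × ℝ} (hΦ : Φ = fun x i => ((f i) x • extChartAt I (f.c i) x, (f i) x))
    (x : M) (hx : x ∈ s) : Injective (mfderiv I 𝓘(ℝ, ι → E × ℝ) Φ x) := by
  apply LinearMap.ker_eq_bot.1
  apply bot_unique
  rw [← (mdifferentiable_chart (f.c (f.ind x hx))).ker_mfderiv_eq_bot
      (f.mem_chartAt_ind_source x hx), ← comp_mfderiv_piTangent f hΦ x hx]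
  exact LinearMap.ker_le_ker_comp _ _

/-- **Norm control through a continuous linear isomorphism**: if `T : W ≃L[ℝ] V` and
`‖T w‖ < 1 / (‖T⁻¹‖ + 1)`, then `‖w‖ < 1`. [folklore] -/
theorem norm_lt_one_of_norm_apply_lt {W V : Type*} [NormedAddCommGroup W] [NormedSpace ℝ W]
    [NormedAddCommGroup V] [NormedSpace ℝ V] (T : W ≃L[ℝ] V) (w : W)
    (hw : ‖T w‖ < 1 / (‖(T.symm : V →L[ℝ] W)‖ + 1)) : ‖w‖ < 1 := by
  have hC0 : 0 ≤ ‖(T.symm : V →L[ℝ] W)‖ := norm_nonneg _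
  have hle : ‖w‖ ≤ ‖(T.symm : V →L[ℝ] W)‖ * ‖T w‖ := by
    have := (T.symm : V →L[ℝ] W).le_opNorm (T w)
    simpa only [ContinuousLinearEquiv.coe_coe, ContinuousLinearEquiv.symm_apply_apply] using this
  have h1 : ‖(T.symm : V →L[ℝ] W)‖ * (1 / (‖(T.symm : V →L[ℝ] W)‖ + 1)) < 1 := by
    rw [mul_one_div, div_lt_one (by linarith)]
    linarith
  have h2 := mul_le_mul_of_nonneg_left hw.le hC0
  linarith

end HelperLocalWhitney

open HelperLocalWhitney in
/-- **Local Whitney embedding, proper near a compact set.**  For a compact set `K` in a Hausdorff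
second-countable smooth `4`-manifold `X` there are an open `U ⊇ K`, a compact `K₁ ⊆ U`, a smooth
`e : X → ℝᵐ` injective with injective differential on `U`, and `η > 0` such that any `q ∈ U` with
`dist (e q) (e p) < η` for some `p ∈ K` lies in `K₁` (Hirsch, *Differential Topology*, Ch. 1 §3,
Thm. 3.4, localised; one extra bump coordinate gives the properness clause). [folklore] -/
theorem helper_localWhitney : ∀ (X : Type) [TopologicalSpace X] [T2Space X]
    [SecondCountableTopology X] [ChartedSpace (EuclideanSpace ℝ (Fin 4)) X]
    [IsManifold (𝓡 4) ∞ X] (K : Set X), IsCompact K → ∃ (U K₁ : Set X) (m : ℕ)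
    (e : X → EuclideanSpace ℝ (Fin m)) (η : ℝ), IsOpen U ∧ IsCompact K₁ ∧ K ⊆ U ∧ K₁ ⊆ U ∧
    0 < η ∧ ContMDiff (𝓡 4) 𝓘(ℝ, EuclideanSpace ℝ (Fin m)) ∞ e ∧ Set.InjOn e U ∧
    (∀ x ∈ U, Function.Injective (mfderiv (𝓡 4) 𝓘(ℝ, EuclideanSpace ℝ (Fin m)) e x)) ∧
    ∀ q ∈ U, ∀ p ∈ K, dist (e q) (e p) < η → q ∈ K₁ := by
  intro X _ _ _ _ _ K hK
  haveI : LocallyCompactSpace X := ChartedSpace.locallyCompactSpace (EuclideanSpace ℝ (Fin 4)) X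
  -- (1) nested open neighbourhoods with compact closures
  obtain ⟨V₁, hV₁o, hKV₁, hV₁c⟩ := exists_isOpen_superset_and_isCompact_closure hK
  obtain ⟨V₂, hV₂o, hV₁V₂, hV₂c⟩ := exists_isOpen_superset_and_isCompact_closure hV₁c
  obtain ⟨V₃, hV₃o, hV₂V₃, hV₃c⟩ := exists_isOpen_superset_and_isCompact_closure hV₂c
  -- (2) a finite smooth bump covering of the compact closed set `closure V₃`
  obtain ⟨ι, f, -⟩ := SmoothBumpCovering.exists_isSubordinate (𝓡 4) (s := closure V₃)
    (U := fun _ => univ) isClosed_closure (fun x _ => Filter.univ_mem)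
  haveI : Finite ι := finite_index f hV₃c
  letI : Fintype ι := Fintype.ofFinite ι
  obtain ⟨Φ, hΦ⟩ : ∃ Φ : X → ι → EuclideanSpace ℝ (Fin 4) × ℝ,
      Φ = fun x i => ((f i) x • extChartAt (𝓡 4) (f.c i) x, (f i) x) := ⟨_, rfl⟩
  -- (3) a bump coordinate: `1` on `closure V₁ ⊇ K`, `0` off `V₂`
  obtain ⟨g, hg0, hg1, -⟩ := exists_contMDiffMap_zero_one_of_isClosed (𝓡 4) (n := (⊤ : ℕ∞))
    hV₂o.isClosed_compl isClosed_closure (disjoint_compl_left_iff_subset.mpr hV₁V₂)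
  -- (4) the finite-dimensional target, identified with a Euclidean space
  obtain ⟨m, T⟩ :
      Σ m : ℕ, ((ι → EuclideanSpace ℝ (Fin 4) × ℝ) × ℝ) ≃L[ℝ] EuclideanSpace ℝ (Fin m) :=
    ⟨_, ContinuousLinearEquiv.ofFinrankEq finrank_euclideanSpace_fin.symm⟩
  obtain ⟨F, hF⟩ : ∃ F : X → (ι → EuclideanSpace ℝ (Fin 4) × ℝ) × ℝ,
      F = fun x => (Φ x, g x) := ⟨_, rfl⟩
  have hFs : ContMDiff (𝓡 4) 𝓘(ℝ, (ι → EuclideanSpace ℝ (Fin 4) × ℝ) × ℝ) ∞ F :=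
    hF ▸ (contMDiff_piTangent f hΦ).prodMk_space g.contMDiff
  have hes : ContMDiff (𝓡 4) 𝓘(ℝ, EuclideanSpace ℝ (Fin m)) ∞ (⇑T ∘ F) :=
    T.contDiff.comp_contMDiff hFs
  obtain ⟨C, hC⟩ : ∃ C : ℝ,
      C = ‖(T.symm : EuclideanSpace ℝ (Fin m) →L[ℝ] (ι → EuclideanSpace ℝ (Fin 4) × ℝ) × ℝ)‖ :=
    ⟨_, rfl⟩
  have hC0 : 0 ≤ C := hC ▸ norm_nonneg _
  refine ⟨V₃, closure V₂, m, ⇑T ∘ F, 1 / (C + 1), hV₃o, hV₂c,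
    hKV₁.trans (subset_closure.trans (hV₁V₂.trans (subset_closure.trans hV₂V₃))), hV₂V₃,
    div_pos one_pos (add_pos_of_nonneg_of_pos hC0 one_pos), hes, ?_, ?_, ?_⟩
  · -- injectivity on `U = V₃ ⊆ closure V₃`
    intro x hx y hy hxy
    have h1 : F x = F y := T.injective hxy
    simp only [hF, Prod.mk.injEq] at h1
    exact injOn_piTangent f hΦ (subset_closure hx) (subset_closure hy) h1.1
  · -- injectivity of the differential on `U`: the first component `Φ = (pr₁ ∘ T⁻¹) ∘ e` has one
    intro x hx
    have he : MDifferentiableAt (𝓡 4) 𝓘(ℝ, EuclideanSpace ℝ (Fin m)) (⇑T ∘ F) x :=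
      hes.mdifferentiableAt (by simp)
    obtain ⟨P, hP⟩ : ∃ P : EuclideanSpace ℝ (Fin m) →L[ℝ] (ι → EuclideanSpace ℝ (Fin 4) × ℝ),
        P = (ContinuousLinearMap.fst ℝ (ι → EuclideanSpace ℝ (Fin 4) × ℝ) ℝ).comp
          (T.symm : EuclideanSpace ℝ (Fin m) →L[ℝ] (ι → EuclideanSpace ℝ (Fin 4) × ℝ) × ℝ) :=
      ⟨_, rfl⟩
    have hcomp := P.hasMFDerivAt.comp x he.hasMFDerivAt
    have hPe : ⇑P ∘ (⇑T ∘ F) = Φ := by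
      funext y
      simp [hP, hF]
    rw [hPe] at hcomp
    have hinj := injective_mfderiv_piTangent f hΦ x (subset_closure hx)
    rw [hcomp.mfderiv] at hinj
    intro v w hvw
    exact hinj (congrArg P hvw)
  · -- properness near `K`
    intro q hq p hp hdist
    by_contra hqK₁
    have hgq : g q = 0 := by
      simpa using hg0 (show q ∈ V₂ᶜ from fun h => hqK₁ (subset_closure h))
    have hgp : g p = 1 := by simpa using hg1 (subset_closure (hKV₁ hp))
    have h2 : ‖(F q - F p).2‖ = 1 := by simp [hF, hgq, hgp]
    have hnorm : (1 : ℝ) ≤ ‖F q - F p‖ := h2 ▸ norm_snd_le (F q - F p)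
    have hdist' : ‖T (F q - F p)‖ < 1 / (C + 1) := by
      rw [map_sub, ← dist_eq_norm]
      exact hdist
    rw [hC] at hdist'
    have := norm_lt_one_of_norm_apply_lt T (F q - F p) hdist'
    linarith
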